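import Summits.KontsevichZagierPeriods.KontsevichZagierPeriods.Theorems.PlanarAreas.Negative.Core
import Summits.KontsevichZagierPeriods.KontsevichZagierPeriods.Theorems.PlanarAreas.Negative.WindowDefect
import Literature.Barriers.KontsevichZagierPeriods.AlgebraicPrimitivesObstruction

/-!
# `PlanarAreas` (stmt-KontsevichZagierPeriods-4990): negative side — VI. RULE 2 IS LOAD-BEARING

`not_withoutRule2`: the sub-calculus generated by domain additivity (1a), integrand additivity (1b)
and Newton–Leibniz (3) — chains through ALL dimensions allowed, but NO change of variables — does
not prove the crux.  Witness: the hyperbola region `R = {1<x<2, 0<y<1/x}` against its translate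
`R + (3,0)` (equal areas by translation invariance).  Along rule-1a/1b/3 chains the window values
`e ↦ Λₑ([R] − [R+(3,0)])` would be semialgebraic up to a constant (`winSemialgebraic_of_mem`), but
they equal `log e` on `[1,2]` (`restrictedEval_win_hypRep`, Fubini over the hyperbola), and
`t ↦ log (2 − t)` has derivative `1/(t − 2)`, which no `ℚ`-semialgebraic function on `[0,1]` has —
the tree's barrier fact `Literature.Barriers.KontsevichZagierPeriods.KZ.noSemialgebraicPrimitive_inv_sub_two_holds`.
Consequences: every chain for `PlanarAreas` contains a genuine change of variables (the pair itself
IS equivalent in the full calculus — a coordinate swap plus Cavalieri in `y`, or the dimension-1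
translation `x ↦ x + 3` between the Newton–Leibniz shadows `[(1,2), 1/x]`, `[(4,5), 1/(x−3)]` — so it
is no counterexample to the crux; route CommonUnfolding's level class must keep its permutations); translations of regions with ALGEBRAIC window primitives (the unit square) ARE
derivable without rule 2, through dimension `0`.

REPAIR 2026-08-19 (cell pub-kz1p, seat b2b-kz1p-1; ONE identifier removed from an `open … (…)` list, NO statement,
proof or declaration changed): the explicit open list below named `PlanarTransport`, dropped from
`Theses/SymplecticScissors.lean` by the items-cap lint autofix of 2026-08-16T14:16:23Z and unused in this file; with it
the module did not elaborate at HEAD (same repair as `Core.lean`). -/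

noncomputable section

open Set MeasureTheory MvPolynomial Filter Topology
open Literature.NumberTheory.Transcendental Literature.ModelTheory.ExponentialFields

namespace Summit.KontsevichZagierPeriods.PlanarAreas.Negative

open Summit.KontsevichZagierPeriods.KontsevichZagierPeriods.Theses.SymplecticScissors
  (PlanarAreas VolumeForm PlanarK0Injective GroupToAreas)

/-! ### The witness pair: the hyperbola region and its horizontal translate -/

/-- `R = {1 < x < 2, 0 < y < 1/x}` (area `log 2`). -/
def hypSet : Set (Fin 2 → ℝ) := {p | 1 < p 0 ∧ p 0 < 2 ∧ 0 < p 1 ∧ p 0 * p 1 < 1}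

/-- `R + (3, 0) = {4 < x < 5, 0 < y < 1/(x − 3)}`. -/
def hypShiftSet : Set (Fin 2 → ℝ) := {p | 4 < p 0 ∧ p 0 < 5 ∧ 0 < p 1 ∧ (p 0 - 3) * p 1 < 1}

/-- The hyperbola region is `ℚ`-semialgebraic (`1 < x < 2`, `0 < y`, `xy < 1`). -/
theorem isSemialgebraic_hypSet : IsSemialgebraic ℚ hypSet := by
  have h0 := isSemialgebraic_setOf_eval_lt (k := ℚ) (R := ℝ) (ι := Fin 2) (C 1) (X 0)
  have h1 := isSemialgebraic_setOf_eval_lt (k := ℚ) (R := ℝ) (ι := Fin 2) (X 0) (C 2)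
  have h2 := isSemialgebraic_setOf_eval_lt (k := ℚ) (R := ℝ) (ι := Fin 2) (C 0) (X 1)
  have h3 := isSemialgebraic_setOf_eval_lt (k := ℚ) (R := ℝ) (ι := Fin 2) (X 0 * X 1) (C 1)
  have hEq : hypSet =
      {x : Fin 2 → ℝ | aeval x (C 1 : MvPolynomial (Fin 2) ℚ) < aeval x (X 0 : MvPolynomial (Fin 2) ℚ)} ∩
      ({x : Fin 2 → ℝ | aeval x (X 0 : MvPolynomial (Fin 2) ℚ) < aeval x (C 2 : MvPolynomial (Fin 2) ℚ)} ∩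
      ({x : Fin 2 → ℝ | aeval x (C 0 : MvPolynomial (Fin 2) ℚ) < aeval x (X 1 : MvPolynomial (Fin 2) ℚ)} ∩
      {x : Fin 2 → ℝ | aeval x (X 0 * X 1 : MvPolynomial (Fin 2) ℚ) < aeval x (C 1 : MvPolynomial (Fin 2) ℚ)})) := by
    ext p
    simp [hypSet]
  rw [hEq]
  exact h0.inter (h1.inter (h2.inter h3))

/-- The translated hyperbola region is `ℚ`-semialgebraic. -/
theorem isSemialgebraic_hypShiftSet : IsSemialgebraic ℚ hypShiftSet := by
  have h0 := isSemialgebraic_setOf_eval_lt (k := ℚ) (R := ℝ) (ι := Fin 2) (C 4) (X 0)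
  have h1 := isSemialgebraic_setOf_eval_lt (k := ℚ) (R := ℝ) (ι := Fin 2) (X 0) (C 5)
  have h2 := isSemialgebraic_setOf_eval_lt (k := ℚ) (R := ℝ) (ι := Fin 2) (C 0) (X 1)
  have h3 := isSemialgebraic_setOf_eval_lt (k := ℚ) (R := ℝ) (ι := Fin 2) ((X 0 - C 3) * X 1) (C 1)
  have hEq : hypShiftSet =
      {x : Fin 2 → ℝ | aeval x (C 4 : MvPolynomial (Fin 2) ℚ) < aeval x (X 0 : MvPolynomial (Fin 2) ℚ)} ∩
      ({x : Fin 2 → ℝ | aeval x (X 0 : MvPolynomial (Fin 2) ℚ) < aeval x (C 5 : MvPolynomial (Fin 2) ℚ)} ∩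
      ({x : Fin 2 → ℝ | aeval x (C 0 : MvPolynomial (Fin 2) ℚ) < aeval x (X 1 : MvPolynomial (Fin 2) ℚ)} ∩
      {x : Fin 2 → ℝ | aeval x ((X 0 - C 3) * X 1 : MvPolynomial (Fin 2) ℚ) < aeval x (C 1 : MvPolynomial (Fin 2) ℚ)})) := by
    ext p
    simp [hypShiftSet]
  rw [hEq]
  exact h0.inter (h1.inter (h2.inter h3))

/-- The translated region is the preimage of `R` under the translation by `(−3, 0)`. -/
theorem hypShiftSet_eq_preimage :
    hypShiftSet = (fun p : Fin 2 → ℝ => (![-3, 0] : Fin 2 → ℝ) + p) ⁻¹' hypSet := by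
  ext p
  simp only [hypShiftSet, hypSet, mem_setOf_eq, mem_preimage, Pi.add_apply, Matrix.cons_val_zero,
    Matrix.cons_val_one]
  constructor
  · rintro ⟨h1, h2, h3, h4⟩
    exact ⟨by linarith, by linarith, by linarith, by nlinarith⟩
  · rintro ⟨h1, h2, h3, h4⟩
    exact ⟨by linarith, by linarith, by linarith, by nlinarith⟩

/-- Translation invariance of Lebesgue measure: `vol(R + (3,0)) = vol(R)`. -/
theorem volume_hypShiftSet : volume hypShiftSet = volume hypSet := by
  rw [hypShiftSet_eq_preimage]
  exact measure_preimage_add _ _ _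

/-- `R` has finite area (it lies in the box `[1,2] × [0,1]`). -/
theorem volume_hypSet_lt_top : volume hypSet < ⊤ := by
  have hsub : hypSet ⊆ Icc (![1, 0] : Fin 2 → ℝ) ![2, 1] := by
    intro p hp
    obtain ⟨h1, h2, h3, h4⟩ := hp
    have h5 : p 1 < 1 := by nlinarith
    rw [mem_Icc, Pi.le_def, Pi.le_def]
    refine ⟨fun i => ?_, fun i => ?_⟩ <;> fin_cases i <;> simp <;> linarith
  exact (measure_mono hsub).trans_lt measure_Icc_lt_top

/-- `[R, 1]`. -/
def hypRep : KZ.IntegralRep 2 :=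
  constOneRep hypSet isSemialgebraic_hypSet volume_hypSet_lt_top.ne

/-- `[R + (3,0), 1]`. -/
def hypShiftRep : KZ.IntegralRep 2 :=
  constOneRep hypShiftSet isSemialgebraic_hypShiftSet
    (by rw [volume_hypShiftSet]; exact volume_hypSet_lt_top.ne)

/-- The domain of `hypRep`. -/
@[simp] theorem hypRep_domain : hypRep.domain = hypSet := rfl

/-- The domain of `hypShiftRep`. -/
@[simp] theorem hypShiftRep_domain : hypShiftRep.domain = hypShiftSet := rfl

/-- The two representations have the same value (equal areas). -/
theorem value_hypRep_eq : hypRep.value = hypShiftRep.value := by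
  rw [hypRep, hypShiftRep, value_constOneRep, value_constOneRep, volume_hypShiftSet]

/-- The translate is invisible in the windows `e ≤ 4`. -/
theorem restrictedEval_win_hypShiftRep {e : ℝ} (he : e ≤ 4) :
    KZ.restrictedEval (win e) (KZ.of hypShiftRep) = 0 := by
  have hempty : hypShiftRep.domain ∩ win e 2 = ∅ := by
    ext p
    simp only [mem_inter_iff, mem_empty_iff_false, iff_false, not_and]
    intro hp hw
    have h1 : 4 < p 0 := hp.1
    have h2 : p 0 < e := hw
    linarith
  rw [KZ.restrictedEval_of, hempty, Measure.restrict_empty, integral_zero_measure]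

/-- The window values of `R`: `vol(R ∩ {x < e}) = log e` for `1 ≤ e ≤ 2` (Fubini over the
hyperbola: `∫₁ᵉ dx/x`). -/
theorem restrictedEval_win_hypRep {e : ℝ} (he : e ∈ Icc (1:ℝ) 2) :
    KZ.restrictedEval (win e) (KZ.of hypRep) = Real.log e := by
  have he1 : (1:ℝ) ≤ e := he.1
  have hepos : 0 < e := by linarith
  -- the windowed region is the region under `1/x` over `(1, e)`
  have hset : hypRep.domain ∩ win e 2 =
      MeasurableEquiv.finTwoArrow ⁻¹' regionBetween (fun _ => 0) (fun x => x⁻¹) (Ioo 1 e) := by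
    ext p
    simp only [mem_inter_iff, mem_preimage, regionBetween, mem_setOf_eq, mem_Ioo,
      MeasurableEquiv.finTwoArrow_apply]
    show (1 < p 0 ∧ p 0 < 2 ∧ 0 < p 1 ∧ p 0 * p 1 < 1) ∧ p 0 < e ↔ _
    constructor
    · rintro ⟨⟨h1, h2, h3, h4⟩, h5⟩
      have h0 : 0 < p 0 := by linarith
      refine ⟨⟨h1, h5⟩, h3, ?_⟩
      rw [lt_inv_comm₀ h3 h0]  -- p 1 < (p 0)⁻¹ ↔ p 0 < (p 1)⁻¹
      rw [lt_inv_comm₀ h0 h3]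
      rw [← one_div, lt_div_iff₀ h0]
      linarith [mul_comm (p 0) (p 1)]
    · rintro ⟨⟨h1, h5⟩, h3, h4⟩
      have h0 : 0 < p 0 := by linarith
      refine ⟨⟨h1, by linarith [he.2], h3, ?_⟩, h5⟩
      rw [← one_div, lt_div_iff₀ h0] at h4
      linarith [mul_comm (p 0) (p 1)]
  have hmeas : MeasurableSet (regionBetween (fun _ => (0:ℝ)) (fun x => x⁻¹) (Ioo 1 e)) :=
    measurableSet_regionBetween measurable_const measurable_inv measurableSet_Ioo
  have hint : IntegrableOn (fun x : ℝ => x⁻¹) (Ioo 1 e) := by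
    have hc : ContinuousOn (fun x : ℝ => x⁻¹) (Icc 1 e) :=
      continuousOn_inv₀.mono fun x hx => by
        simp only [mem_compl_iff, mem_singleton_iff]
        exact ne_of_gt (show (0:ℝ) < x by linarith [hx.1])
    exact (hc.integrableOn_compact isCompact_Icc).mono_set Ioo_subset_Icc_self
  have hvol : volume (hypRep.domain ∩ win e 2) = ENNReal.ofReal (Real.log e) := by
    rw [hset, (volume_preserving_finTwoArrow ℝ).measure_preimage hmeas.nullMeasurableSet,
      Measure.volume_eq_prod, volume_regionBetween_eq_integral integrableOn_zero hint
        measurableSet_Ioo (fun x hx => by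
          show (0:ℝ) ≤ x⁻¹
          exact inv_nonneg.mpr (by linarith [hx.1]))]
    congr 1
    have : ∫ y in Ioo 1 e, ((fun x : ℝ => x⁻¹) - fun _ : ℝ => (0:ℝ)) y = ∫ y in (1:ℝ)..e, y⁻¹ := by
      rw [intervalIntegral.integral_of_le he1, integral_Ioc_eq_integral_Ioo]
      simp
    rw [this, integral_inv_of_pos one_pos hepos, div_one]
  rw [KZ.restrictedEval_of]
  show ∫ _ in hypRep.domain ∩ win e 2, (1:ℝ) = Real.log e
  rw [setIntegral_const, smul_eq_mul, mul_one, measureReal_def, hvol,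
    ENNReal.toReal_ofReal (Real.log_nonneg he1)]

/-! ### The refutation -/

/-- STRENGTHENING: chains WITHOUT rule 2 — only domain additivity (1a), integrand additivity (1b)
and Newton–Leibniz (3), through any dimensions. -/
def WithoutRule2 : Prop :=
  ∀ (r r' : KZ.IntegralRep 2), (∀ p ∈ r.domain, r.integrand p = 1) →
    (∀ p ∈ r'.domain, r'.integrand p = 1) → r.value = r'.value →
    KZ.of r - KZ.of r' ∈
      AddSubgroup.closure (KZ.domainAddRel ∪ KZ.integrandAddRel ∪ KZ.newtonLeibnizRel)

/-- **Rule 2 is load-bearing.** The hyperbola region `R = {1<x<2, 0<y<1/x}` and its translate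
`R + (3,0)` have equal area (`log 2`) but `[R] − [R + (3,0)]` is NOT in the subgroup generated by
rules 1a, 1b, 3: along such chains the first-coordinate window values `e ↦ Λₑ` are semialgebraic
up to a constant (`winSemialgebraic_of_mem`), whereas here they equal `log e` on `[1,2]`
(`restrictedEval_win_hypRep`), and `t ↦ log (2 − t)` has derivative `1/(t − 2)`, which no
`ℚ`-semialgebraic function on `[0,1]` has (tree barrier fact
`noSemialgebraicPrimitive_inv_sub_two_holds`).  Every chain proving the crux uses a change of
variables. -/
theorem not_withoutRule2 : ¬ WithoutRule2 := by
  intro h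
  have hmem := h hypRep hypShiftRep (fun _ _ => rfl) (fun _ _ => rfl) value_hypRep_eq
  obtain ⟨Φ, K, hΦ, hwin⟩ := winSemialgebraic_of_mem hmem
  have hlog : ∀ e ∈ Icc (1:ℝ) 2, Φ e + K = Real.log e := by
    intro e he
    rw [← hwin e, map_sub, restrictedEval_win_hypRep he,
      restrictedEval_win_hypShiftRep (he.2.trans (by norm_num)), sub_zero]
  have hI : IsSemialgebraic ℚ {x : Fin 1 → ℝ | x 0 ∈ Icc (0:ℝ) 1} := by
    have h0 := isSemialgebraic_setOf_eval_le (k := ℚ) (R := ℝ) (ι := Fin 1) (C 0) (X 0)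
    have h1 := isSemialgebraic_setOf_eval_le (k := ℚ) (R := ℝ) (ι := Fin 1) (X 0) (C 1)
    have hEq : {x : Fin 1 → ℝ | x 0 ∈ Icc (0:ℝ) 1} =
        {x : Fin 1 → ℝ | aeval x (C 0 : MvPolynomial (Fin 1) ℚ) ≤ aeval x (X 0 : MvPolynomial (Fin 1) ℚ)} ∩
        {x : Fin 1 → ℝ | aeval x (X 0 : MvPolynomial (Fin 1) ℚ) ≤ aeval x (C 1 : MvPolynomial (Fin 1) ℚ)} := by
      ext x
      simp
    rw [hEq]
    exact h0.inter h1
  refine Literature.Barriers.KontsevichZagierPeriods.KZ.noSemialgebraicPrimitive_inv_sub_two_holds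
    ⟨fun z => Φ (2 - z 0), ?_, ?_⟩
  · have hm : IsSemialgebraicMapOn ℚ {x : Fin 1 → ℝ | x 0 ∈ Icc (0:ℝ) 1}
        (fun z : Fin 1 → ℝ => fun _ : Fin 1 => 2 - z 0) := by
      have := isSemialgebraicMapOn_aeval (k := ℚ) (R := ℝ) hI
        (fun _ : Fin 1 => (C 2 - X 0 : MvPolynomial (Fin 1) ℚ))
      convert this using 2 with z
      funext j
      simp
    exact IsSemialgebraicFunOn.comp_isSemialgebraicMapOn_holds hΦ hm (fun _ _ => mem_univ _)
  · intro t ht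
    have hEq : (fun s : ℝ => Φ (2 - (fun _ : Fin 1 => s) 0)) =ᶠ[𝓝 t]
        fun s => Real.log (2 - s) - K := by
      filter_upwards [Ioo_mem_nhds ht.1 ht.2] with s hs
      have h2s : 2 - s ∈ Icc (1:ℝ) 2 := ⟨by linarith [hs.2], by linarith [hs.1]⟩
      have := hlog (2 - s) h2s
      show Φ (2 - s) = Real.log (2 - s) - K
      linarith
    refine HasDerivAt.congr_of_eventuallyEq ?_ hEq
    have h1 : HasDerivAt (fun s : ℝ => 2 - s) (-1) t := by
      simpa using (hasDerivAt_id t).const_sub 2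
    have h2 : HasDerivAt (fun s : ℝ => Real.log (2 - s)) ((2 - t)⁻¹ * (-1)) t :=
      (Real.hasDerivAt_log (show (2 - t) ≠ 0 by linarith [ht.2])).comp t h1
    have h3 := h2.sub_const K
    convert h3 using 1
    have : (t - 2) ≠ 0 := by linarith [ht.2]
    have : (2 - t) ≠ 0 := by linarith [ht.2]
    field_simp
    ring

end Summit.KontsevichZagierPeriods.PlanarAreas.Negative

end
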